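import Literature.NumberTheory.GaloisRepresentations.RayClassGroup
import Literature.NumberTheory.NumberFields.RelativeNormPositivity
import Mathlib.RingTheory.IntegralClosure.IntegralRestrict
import Mathlib.RingTheory.Localization.AtPrime.Basic
import Mathlib.RingTheory.DedekindDomain.Dvr
import Mathlib.NumberTheory.NumberField.Norm
import HarnessLib

/-!
# Norms of ray elements are ray elements: `N_{E/F}(P_E^{𝔪𝓞_E}) ≤ P_F^𝔪`

Topic `NumberTheory/GaloisRepresentations` (class field theory, next to `RayClassGroup.lean`:
`rayElements 𝔪 ≤ Kˣ`, the elements `≡ 1 mod 𝔪` and totally positive); namespace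
`Literature.NumberTheory.GaloisRepresentations`.  Theorems only, fully proved.

## What is proved

* `norm_sub_norm_mem_of_sub_mem_map` — for a finite free algebra `B/A` and an ideal `I ≤ A`:
  `z₁ ≡ z₂ (mod I B) ⟹ N_{B/A}(z₁) ≡ N_{B/A}(z₂) (mod I)` (the norm is the determinant of the
  multiplication matrix in a basis, and the two matrices are congruent entrywise,
  `leftMulMatrix_apply_mem_of_mem_map`).
* `intNorm_sub_intNorm_mem_pow` — the same for a finite extension `S/R` of Dedekind domains and a
  prime power `𝔭ᵏ` of `R` (localise at `𝔭`, where `S_𝔭` is free over the discrete valuation ring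
  `R_𝔭`; Mathlib `Algebra.intNorm_eq_of_isLocalization`, `Algebra.intNorm_eq_norm`).
* `intNorm_notMem_of_isCoprime_map` — `c` prime to `𝔭𝓞_S ⟹ N(c) ∉ 𝔭` (`c d ≡ 1 mod 𝔭 S` for
  some `d`, so `N(c) N(d) ≡ 1 mod 𝔭`).
* `norm_mem_rayElements` — **for number fields `E/F` and `𝔪 ≠ 0`: `a ≡ 1 mod 𝔪𝓞_E`, `a ≫ 0`
  `⟹ N_{E/F}(a) ≡ 1 mod 𝔪`, `N_{E/F}(a) ≫ 0`** (write `a = b/c` with `c` prime to `𝔪𝓞_E`,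
  `b ≡ c`, `bc ≫ 0` — `exists_eq_div_of_mem_rayElements` — and use the three lemmas above together
  with `Literature.NumberTheory.NumberFields.embedding_norm_pos_of_totallyPositive`).

This is the step "`N_{E_i/F}(α_{E_i}) ≡ 1 (mod 𝔪)`, `N_{E_i/F}(α_{E_i}) ≫ 0`, hence
`⟨N_{E_i/F}(α_{E_i})⟩ ∈ 𝒫⁺_{F,𝔪}`" of Childress's proof of Prop. 2.2 (Ch. 5 §2, PDF p. 125) in
Artin's proof of the reciprocity law `artinReciprocity_rankOne`.

## References

* N. Childress, *Class Field Theory*, Universitext, Springer 2009, Ch. 5 §2, proof of Prop. 2.2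
  (PDF p. 125). [Childress2009]
-/

noncomputable section

open NumberField IsDedekindDomain

open scoped nonZeroDivisors

namespace Literature.NumberTheory.GaloisRepresentations

/-! ### Congruent elements have congruent norms: the free case -/

section Free

variable {A B ι : Type*} [CommRing A] [CommRing B] [Algebra A B] [Fintype ι] [DecidableEq ι]

/-- The multiplication matrix of an element of `I B` in an `A`-basis of `B` has entries in `I`.
[folklore] -/
theorem leftMulMatrix_apply_mem_of_mem_map (b : Module.Basis ι A B) {I : Ideal A} {y : B}
    (hy : y ∈ I.map (algebraMap A B)) (i j : ι) : Algebra.leftMulMatrix b y i j ∈ I := by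
  rw [Algebra.leftMulMatrix_eq_repr_mul]
  have hsm : y * b j ∈ I • (⊤ : Submodule A B) := by
    rw [Ideal.smul_top_eq_map]
    exact Ideal.mul_mem_right _ _ hy
  rw [← b.span_eq] at hsm
  obtain ⟨a, ha, hsum⟩ := (Submodule.mem_ideal_smul_span_iff_exists_sum I b (y * b j)).mp hsm
  rw [← hsum, ← Finsupp.linearCombination_apply, b.repr_linearCombination]
  exact ha i

/-- **Congruent elements have congruent norms** (free case): for a finite free `A`-algebra `B` and
an ideal `I ≤ A`, `z₁ - z₂ ∈ I B ⟹ N_{B/A}(z₁) - N_{B/A}(z₂) ∈ I` (determinants of entrywise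
congruent multiplication matrices). [folklore] -/
theorem norm_sub_norm_mem_of_sub_mem_map [Module.Free A B] [Module.Finite A B] (I : Ideal A)
    {z₁ z₂ : B} (h : z₁ - z₂ ∈ I.map (algebraMap A B)) :
    Algebra.norm A z₁ - Algebra.norm A z₂ ∈ I := by
  classical
  let b := Module.Free.chooseBasis A B
  rw [Algebra.norm_eq_matrix_det b, Algebra.norm_eq_matrix_det b, ← Ideal.Quotient.eq,
    RingHom.map_det, RingHom.map_det]
  congr 1
  ext i j
  rw [RingHom.mapMatrix_apply, RingHom.mapMatrix_apply, Matrix.map_apply, Matrix.map_apply,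
    Ideal.Quotient.eq, ← Matrix.sub_apply, ← map_sub]
  exact leftMulMatrix_apply_mem_of_mem_map b h i j

end Free

/-! ### Congruent elements have congruent norms: Dedekind domains -/

section Dedekind

variable {R S : Type*} [CommRing R] [IsDedekindDomain R] [CommRing S] [IsDomain S] [Algebra R S]
  [Module.Finite R S] [Module.IsTorsionFree R S] [IsIntegrallyClosed S]

/-- **Congruent elements have congruent norms** for a finite extension `S/R` of Dedekind domains
and a prime power: `z₁ - z₂ ∈ 𝔭ᵏ S ⟹ N_{S/R}(z₁) - N_{S/R}(z₂) ∈ 𝔭ᵏ` (Mathlib's `Algebra.intNorm`).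
Localising at `𝔭`, `S_𝔭` is free of finite rank over the discrete valuation ring `R_𝔭`, the norm
localises (`Algebra.intNorm_eq_of_isLocalization`) and is a determinant there
(`norm_sub_norm_mem_of_sub_mem_map`); finally `𝔭ᵏ R_𝔭 ∩ R = 𝔭ᵏ`. [folklore] -/
theorem intNorm_sub_intNorm_mem_pow (p : Ideal R) [p.IsMaximal] (k : ℕ) {z₁ z₂ : S}
    (h : z₁ - z₂ ∈ (p ^ k).map (algebraMap R S)) :
    Algebra.intNorm R S z₁ - Algebra.intNorm R S z₂ ∈ p ^ k := by
  -- the localisations `R_𝔭`, `S_𝔭` (as in Mathlib's `Algebra.trace_quotient_eq_of_isDedekindDomain`)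
  let Rₚ := Localization.AtPrime p
  let Sₚ := Localization (Algebra.algebraMapSubmonoid S p.primeCompl)
  letI : Algebra Rₚ Sₚ := localizationAlgebra p.primeCompl S
  haveI : IsScalarTower R Rₚ Sₚ := IsScalarTower.of_algebraMap_eq'
    (by rw [RingHom.algebraMap_toAlgebra, IsLocalization.map_comp, ← IsScalarTower.algebraMap_eq])
  haveI : IsLocalization (Submonoid.map (algebraMap R S) (Ideal.primeCompl p)) Sₚ :=
    inferInstanceAs (IsLocalization (Algebra.algebraMapSubmonoid S p.primeCompl) Sₚ)
  have e : Algebra.algebraMapSubmonoid S p.primeCompl ≤ S⁰ :=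
    Submonoid.map_le_of_le_comap _ <| p.primeCompl_le_nonZeroDivisors.trans
      (nonZeroDivisors_le_comap_nonZeroDivisors_of_injective _
        (FaithfulSMul.algebraMap_injective _ _))
  haveI : IsDomain Sₚ := IsLocalization.isDomain_of_le_nonZeroDivisors _ e
  haveI : Module.IsTorsionFree Rₚ Sₚ := by
    rw [Module.isTorsionFree_iff_algebraMap_injective, RingHom.injective_iff_ker_eq_bot,
      RingHom.ker_eq_bot_iff_eq_zero]
    simp
  haveI : Module.Finite Rₚ Sₚ := .of_isLocalization R S p.primeCompl
  haveI : IsIntegrallyClosed Sₚ := isIntegrallyClosed_of_isLocalization _ _ e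
  have : IsPrincipalIdealRing Rₚ := by
    by_cases hp : p = ⊥
    · infer_instance
    · have := (IsDedekindDomain.isDedekindDomainDvr R).2 p hp inferInstance
      infer_instance
  haveI : Module.Free Rₚ Sₚ := Module.free_of_finite_type_torsion_free'
  -- transfer the hypothesis to `S_𝔭` and use the free case
  have h' : algebraMap S Sₚ z₁ - algebraMap S Sₚ z₂ ∈
      ((IsLocalRing.maximalIdeal Rₚ) ^ k).map (algebraMap Rₚ Sₚ) := by
    rw [← map_sub, ← Localization.AtPrime.map_eq_maximalIdeal, ← Ideal.map_pow, Ideal.map_map,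
      ← IsScalarTower.algebraMap_eq, IsScalarTower.algebraMap_eq R S Sₚ, ← Ideal.map_map]
    exact Ideal.mem_map_of_mem _ h
  have h2 : Algebra.intNorm Rₚ Sₚ (algebraMap S Sₚ z₁) - Algebra.intNorm Rₚ Sₚ (algebraMap S Sₚ z₂) ∈
      (IsLocalRing.maximalIdeal Rₚ) ^ k := by
    rw [Algebra.intNorm_eq_norm]
    exact norm_sub_norm_mem_of_sub_mem_map _ h'
  rw [← Algebra.intNorm_eq_of_isLocalization (A := R) (B := S) (M := p.primeCompl) (Aₘ := Rₚ)
      (Bₘ := Sₚ) z₁, ← Algebra.intNorm_eq_of_isLocalization (A := R) (B := S) (M := p.primeCompl)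
      (Aₘ := Rₚ) (Bₘ := Sₚ) z₂, ← map_sub,
    ← Localization.AtPrime.map_eq_maximalIdeal, ← Ideal.map_pow] at h2
  -- pull back along `R → R_𝔭`: `𝔭ᵏ R_𝔭 ∩ R = 𝔭ᵏ`
  obtain ⟨⟨⟨a, ha⟩, ⟨s, hs⟩⟩, hx⟩ := (IsLocalization.mem_map_algebraMap_iff p.primeCompl Rₚ).mp h2
  have hinjR : Function.Injective (algebraMap R Rₚ) :=
    IsLocalization.injective Rₚ p.primeCompl_le_nonZeroDivisors
  have hx' : (Algebra.intNorm R S z₁ - Algebra.intNorm R S z₂) * s = a :=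
    hinjR (by rw [map_mul]; exact hx)
  have hmem : s * (Algebra.intNorm R S z₁ - Algebra.intNorm R S z₂) ∈ p ^ k := by
    rw [mul_comm, hx']
    exact ha
  rcases Ideal.IsPrime.mul_mem_pow p hmem with hsP | hres
  · exact absurd hsP hs
  · exact hres

/-- **An element prime to `𝔭 S` has norm prime to `𝔭`**: if `(c) + 𝔭S = S` then `N_{S/R}(c) ∉ 𝔭`
(choose `d` with `c d ≡ 1 mod 𝔭S`; then `N(c) N(d) ≡ N(1) = 1 mod 𝔭`). [folklore] -/
theorem intNorm_notMem_of_isCoprime_map (p : Ideal R) [p.IsMaximal] {c : S}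
    (hc : IsCoprime (Ideal.span {c}) (p.map (algebraMap R S))) : Algebra.intNorm R S c ∉ p := by
  obtain ⟨u, hu, w, hw, huw⟩ := Ideal.isCoprime_iff_exists.mp hc
  obtain ⟨d, rfl⟩ := Ideal.mem_span_singleton'.mp hu
  have hsub : d * c - 1 ∈ (p ^ 1).map (algebraMap R S) := by
    rw [pow_one, show d * c - 1 = -w by rw [← huw]; ring]
    exact Submodule.neg_mem _ hw
  have h1 := intNorm_sub_intNorm_mem_pow p 1 hsub
  rw [pow_one, map_mul, map_one] at h1
  intro hcp
  have : (1 : R) ∈ p := by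
    have h2 : Algebra.intNorm R S d * Algebra.intNorm R S c ∈ p := Ideal.mul_mem_left _ _ hcp
    have h3 := Ideal.sub_mem _ h2 h1
    rwa [sub_sub_cancel] at h3
  exact Ideal.IsPrime.ne_top inferInstance ((Ideal.eq_top_iff_one _).mpr this)

end Dedekind

/-! ### Number fields: norms of ray elements -/

section NumberFields

variable {F E : Type*} [Field F] [NumberField F] [Field E] [NumberField E] [Algebra F E]

/-- Mathlib's `Algebra.intNorm` on rings of integers is `RingOfIntegers.norm`. [folklore] -/
theorem intNorm_ringOfIntegers_eq_norm (b : 𝓞 E) :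
    Algebra.intNorm (𝓞 F) (𝓞 E) b = RingOfIntegers.norm F b := by
  apply RingOfIntegers.coe_injective
  rw [Algebra.algebraMap_intNorm (A := 𝓞 F) (K := F) (L := E) (B := 𝓞 E) b,
    ← RingOfIntegers.coe_eq_algebraMap, ← RingOfIntegers.coe_eq_algebraMap, RingOfIntegers.coe_norm]

/-- `N_{E/F}(b) ≠ 0` in `𝓞 F` for a nonzero algebraic integer `b`. [folklore] -/
theorem ringOfIntegers_norm_ne_zero {b : 𝓞 E} (hb : b ≠ 0) : (RingOfIntegers.norm F b : 𝓞 F) ≠ 0 := by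
  intro h
  have h1 : Algebra.norm F (b : E) = 0 := by
    rw [← RingOfIntegers.coe_norm F b, h]
    rfl
  exact hb (RingOfIntegers.coe_injective (by
    rw [map_zero]
    exact Algebra.norm_eq_zero_iff.mp h1))

/-- **Norms of ray elements are ray elements** (Childress, Ch. 5 §2, proof of Prop. 2.2:
"`N_{E_i/F}(α_{E_i}) ≡ 1 mod 𝔪`, `N_{E_i/F}(α_{E_i}) ≫ 0`"): for a finite extension `E/F` of number
fields and `𝔪 ≠ 0`, if `a ∈ Eˣ` is `≡ 1 mod 𝔪𝓞_E` and totally positive (`rayElements (𝔪𝓞_E)`),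
then `N_{E/F}(a)` is `≡ 1 mod 𝔪` and totally positive (`rayElements 𝔪`).  Proof: `a = b/c` with
`c` prime to `𝔪𝓞_E`, `b ≡ c mod 𝔪𝓞_E`, `bc ≫ 0` (`exists_eq_div_of_mem_rayElements`); then `N(c)` is
prime to `𝔪` (`intNorm_notMem_of_isCoprime_map`), `N(b) ≡ N(c) mod 𝔪`
(`intNorm_sub_intNorm_mem_pow` at every `𝔭^{n_𝔭} ∥ 𝔪`), `N(bc) ≫ 0`
(`embedding_norm_pos_of_totallyPositive`), so `N(a) = N(b)/N(c) ∈ rayElements 𝔪`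
(`unitsMk0_div_mem_rayElements`). [cite: Childress2009, Ch. 5 §2, proof of Prop. 2.2 (PDF p. 125)] -/
theorem norm_mem_rayElements {𝔪 : Ideal (𝓞 F)} (h𝔪 : 𝔪 ≠ ⊥) {a : Eˣ}
    (ha : a ∈ rayElements (𝔪.map (algebraMap (𝓞 F) (𝓞 E)))) :
    Units.map (Algebra.norm F : E →* F) a ∈ rayElements 𝔪 := by
  have h𝔪' : 𝔪.map (algebraMap (𝓞 F) (𝓞 E)) ≠ ⊥ :=
    (Ideal.map_eq_bot_iff_of_injective (FaithfulSMul.algebraMap_injective (𝓞 F) (𝓞 E))).not.mpr h𝔪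
  obtain ⟨b, c, hb, hc, hcop, hbc, hpos, hab⟩ := exists_eq_div_of_mem_rayElements h𝔪' ha
  have hNb := ringOfIntegers_norm_ne_zero (F := F) hb
  have hNc := ringOfIntegers_norm_ne_zero (F := F) hc
  -- `N(a) = N(b)/N(c)`
  have hcE : (c : E) ≠ 0 := by exact_mod_cast hc
  have hkey : Units.map (Algebra.norm F : E →* F) a =
      Units.mk0 (((RingOfIntegers.norm F b : 𝓞 F) : F) / ((RingOfIntegers.norm F c : 𝓞 F) : F))
        (div_ne_zero (by exact_mod_cast hNb) (by exact_mod_cast hNc)) := by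
    apply Units.ext
    rw [Units.coe_map, Units.val_mk0, hab, RingOfIntegers.coe_norm,
      RingOfIntegers.coe_norm, eq_div_iff ((Algebra.norm_ne_zero_iff).mpr hcE), ← map_mul,
      div_mul_cancel₀ _ hcE]
  rw [hkey]
  refine unitsMk0_div_mem_rayElements h𝔪 hNb hNc ?_ ?_ ?_
  · -- `N(c)` is prime to `𝔪`
    refine (LFunctions.isCoprime_iff_forall_not_le h𝔪).mpr fun v hle hNcv => ?_
    haveI : v.asIdeal.IsMaximal := v.isMaximal
    have hcop' : IsCoprime (Ideal.span {c}) (v.asIdeal.map (algebraMap (𝓞 F) (𝓞 E))) := by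
      rw [Ideal.isCoprime_iff_sup_eq] at hcop ⊢
      exact top_le_iff.mp (hcop.symm.le.trans (sup_le_sup_left (Ideal.map_mono hle) _))
    have h1 := intNorm_notMem_of_isCoprime_map v.asIdeal hcop'
    rw [intNorm_ringOfIntegers_eq_norm] at h1
    exact h1 ((Ideal.span_singleton_le_iff_mem _).mp hNcv)
  · -- `N(b) ≡ N(c) mod 𝔪`
    refine mem_of_forall_mem_pow_modulusExp h𝔪 fun v _ => ?_
    haveI : v.asIdeal.IsMaximal := v.isMaximal
    have hbc' : b - c ∈ (v.asIdeal ^ modulusExp 𝔪 v).map (algebraMap (𝓞 F) (𝓞 E)) :=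
      Ideal.map_mono (Ideal.le_of_dvd (pow_modulusExp_dvd v)) hbc
    have h1 := intNorm_sub_intNorm_mem_pow v.asIdeal (modulusExp 𝔪 v) hbc'
    rwa [intNorm_ringOfIntegers_eq_norm, intNorm_ringOfIntegers_eq_norm] at h1
  · -- `N(b) N(c) = N(bc) ≫ 0`
    intro φ
    rw [RingOfIntegers.coe_norm, RingOfIntegers.coe_norm, ← map_mul, ← map_mul]
    refine NumberFields.embedding_norm_pos_of_totallyPositive
      (mul_ne_zero (by exact_mod_cast hb) hcE) (fun τ => ?_) φ
    rw [map_mul]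
    exact hpos τ

end NumberFields

end Literature.NumberTheory.GaloisRepresentations
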